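/-
Origin: expansion seat `planner-pub-hodgecm-toy-g2-0`, handover #16 2026-08-18T08:08:04Z (`HOME/pub-hodgecm-toy-g2/lean/ToyG2/NoGysin.lean`, md5 85e7ab77, 128 lines);
landed by the gen-7 packager in gate run 26 as `HodgeCM/Model/ToyG2/NoGysin.lean` (import ^import ToyG2\.→import HodgeCM.Model.ToyG2. ×1).
-/
/-
# HodgeCM.Model.ToyG2.NoGysin — the Gysin axiom FAILS on the full object class `Obj₂`

Generation 2 of the `pub-hodgecm-toy` lineage (seat `planner-pub-hodgecm-toy-g2-0`); an obstruction
found while planning the Gysin leg (DESIGN.md §9).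

`toyModel2With D T pl` takes ALL of `Obj₂` as its varieties, and `Obj₂` contains Picard blocks
`⟨O, ℓ⟩` with an ARBITRARY functional `ℓ` on `⋀⁴`, in particular with `ℓ = 0`.  For the Künneth trace
system `traceSys` this refutes M26 (`Fact_gysin_surface`):  take a block `P` with `ℓ_P ≠ 0`, the block
`U := ⟨P.O, 0⟩`, `X := P × U`, `S := P` and the morphism `f := (id, 0) : S ⟶ X`.  The trace of `X` is
`ℓ_P ⊠ 0 = 0` in every degree (`trOf_prod_zeroBlock`), so the right-hand side of the Gysin identity
vanishes for every candidate class `c`, while the left-hand side `tr_S (f^* y) = ℓ_P (y₀) ≠ 0` for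
`y = pr_P^* y₀`.

* `not_gysin_toyModel2With` : `¬ (toyModel2With D traceSys pl).Fact_gysin_surface` as soon as one block
  with nonzero trace exists (`P : PLeaf`, `P.ℓ ≠ 0`);
* `toyUniverse₂_not_gysin` : the same for `toyUniverse₂ d t` (its own period leaves have `ℓ ≠ 0`).

Consequence (DESIGN.md §9): the 28/28 universe must restrict `Var` to the GOOD objects (every block leaf
has `ℓ ≠ 0` of Hodge type `(2,2)`); the 27 transferred axioms restrict verbatim.
-/
import Mathlib
import Summits.HodgeConjecture.HodgeCM.Model.ToyG2.PeriodLeaf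

namespace HodgeCM.ToyG2

open HodgeCM.Toy
open scoped TensorProduct
open exteriorPower Obj₂

noncomputable section

/-! ### The zero morphism and the zero block -/

/-- (Ported verbatim from the HodgeCMPerL package; no docstring in the source.) -/
lemma isHodge_zero (X Y : Obj) : Obj.IsHodge (X := X) (Y := Y) (0 : Y.L →ₗ[ℚ] X.L) := by
  unfold Obj.IsHodge
  rw [LinearMap.baseChange_zero, Submodule.map_zero]
  exact bot_le

/-- the zero morphism of the generation-2 universe -/
def Obj₂.Hom₂.zero (X Y : Obj₂) : Hom₂ X Y := ⟨⟨0, isHodge_zero X.toObj Y.toObj⟩, Adm.zero X Y⟩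

/-- (Ported verbatim from the HodgeCMPerL package; no docstring in the source.) -/
@[simp] lemma Obj₂.Hom₂.zero_lin (X Y : Obj₂) : (Hom₂.zero X Y).lin = 0 := rfl

/-- the block with the same atoms as `P` and the ZERO trace -/
def zeroBlock (P : PLeaf) : PLeaf := ⟨P.O, 0⟩

/-- (Ported verbatim from the HodgeCMPerL package; no docstring in the source.) -/
lemma form_pbObj (p : PLeaf) : form (pbObj p) = p.ℓ.compAlternatingMap (ιMulti ℚ 4) := rfl

/-- (Ported verbatim from the HodgeCMPerL package; no docstring in the source.) -/
lemma form_pbObj_zeroBlock (P : PLeaf) : form (pbObj (zeroBlock P)) = 0 := by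
  rw [form_pbObj]
  rfl

section Prod
variable {A B : Obj}

/-- (Ported verbatim from the HodgeCMPerL package; no docstring in the source.) -/
theorem prodForm_zero_right {m n : ℕ} (α : A.L [⋀^Fin m]→ₗ[ℚ] ℚ) :
    prodForm α (0 : B.L [⋀^Fin n]→ₗ[ℚ] ℚ) = 0 := by
  rw [prodForm, AlternatingMap.zero_compLinearMap, ← AlternatingMap.domCoprod'_apply,
    TensorProduct.tmul_zero, map_zero, LinearMap.compAlternatingMap_zero,
    AlternatingMap.domDomCongr_zero]

end Prod

/-- the trace of `X × U` vanishes in every degree when the block `U` has zero trace -/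
theorem trOf_prod_zeroBlock (X : Obj₂) (P : PLeaf) (k : ℕ) :
    trOf (X.prod (pbObj (zeroBlock P))) k = 0 := by
  unfold trOf
  split_ifs with h
  · rw [form_prod, form_pbObj_zeroBlock, prodForm_zero_right]
    exact LinearEquiv.map_zero _
  · rfl

/-! ### The refutation -/

variable (D : HodgeData) (pl : PBlocks)

/-- the source of the counterexample: the block `P` itself -/
@[reducible] def ceS (P : PLeaf) : Obj₂ := pbObj P

/-- the target of the counterexample: `P × U` with `U` the zero block on the atoms of `P` -/
@[reducible] def ceX (P : PLeaf) : Obj₂ := (pbObj P).prod (pbObj (zeroBlock P))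

/-- the morphism of the counterexample: `(id, 0) : P ⟶ P × U` -/
def ceF (P : PLeaf) : Hom₂ (ceS P) (ceX P) :=
  Hom₂.lift (Hom₂.id (pbObj P)) (Hom₂.zero (pbObj P) (pbObj (zeroBlock P)))

/-- (Ported verbatim from the HodgeCMPerL package; no docstring in the source.) -/
lemma ceF_lin_comp_inlL (P : PLeaf) :
    (ceF P).lin ∘ₗ Obj.inlL (pbObj P).toObj (pbObj (zeroBlock P)).toObj = LinearMap.id :=
  Hom₂.lift_lin_comp_inlL _ _

/-- left-hand side of the Gysin identity on `y = pr_P^* y₀`: `ℓ_P y₀` -/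
theorem ce_lhs (P : PLeaf) (y₀ : ↥(⋀[ℚ]^4 P.O.L)) :
    trOf (ceS P) 4 (map 4 (ceF P).lin
      (map 4 (Obj.inlL (pbObj P).toObj (pbObj (zeroBlock P)).toObj) y₀)) = P.ℓ y₀ := by
  change trOf (ceS P) 4 ((map 4 (ceF P).lin
      ∘ₗ map 4 (Obj.inlL (pbObj P).toObj (pbObj (zeroBlock P)).toObj)) y₀) = P.ℓ y₀
  rw [← map_comp, ceF_lin_comp_inlL, map_id, LinearMap.id_apply]
  exact congrArg (fun φ => φ y₀) (trOf_pbObj P)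

/-- right-hand side of the Gysin identity: identically `0` -/
theorem ce_rhs (P : PLeaf) (j : ℕ) (y : ↥(⋀[ℚ]^4 (ceX P).L)) (c : ↥(⋀[ℚ]^j (ceX P).L)) :
    trOf (ceX P) (4 + j) (wedge ℚ (ceX P).L 4 j y c) = 0 := by
  rw [trOf_prod_zeroBlock, LinearMap.zero_apply]

/-- **M26 fails on `Obj₂`**: for the Künneth trace system, any Hodge data and any block assignment,
`Fact_gysin_surface` is false as soon as some block has a nonzero trace. -/
theorem not_gysin_toyModel2With (P : PLeaf) (hP : P.ℓ ≠ 0) :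
    ¬ (toyModel2With D traceSys pl).Fact_gysin_surface := by
  intro hG
  obtain ⟨y₀, hy₀⟩ : ∃ y₀, P.ℓ y₀ ≠ 0 := by
    by_contra h
    simp only [not_exists, not_not] at h
    exact hP (LinearMap.ext fun y => by rw [h y, LinearMap.zero_apply])
  obtain ⟨c, -, hc⟩ := hG (ceS P) (ceX P) (ceF P) (dim_pbObj P)
  have h1 := hc (map 4 (Obj.inlL (pbObj P).toObj (pbObj (zeroBlock P)).toObj) y₀)
  rw [tr_eq, tr_eq, pull_eq, cup_eq, traceSys_tr, ce_lhs, ce_rhs] at h1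
  exact hy₀ h1

/-- **M26 fails for `toyUniverse₂ d t`** (whose own period leaves have nonzero trace); hence the
generation-2 universe must restrict its varieties to the good objects (DESIGN.md §9). -/
theorem toyUniverse₂_not_gysin (d t : ℚ) (L : CMField) (ι₁ : L →+* ℂ) :
    ¬ (toyUniverse₂ d t).Fact_gysin_surface :=
  not_gysin_toyModel2With exteriorHodgeData (plOf d t) (pLeafOf L ι₁ d t) (pLeafOf_ℓ_ne_zero L ι₁ d t)

end

end HodgeCM.ToyG2
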